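import Summits.Ventures.PercRepro.CoreCountCore
import Summits.Ventures.PercRepro.RankLevelSetFrameQ
import Summits.Ventures.PercRepro.TheoremOAll
import Summits.Ventures.PercRepro.SixThreeFinal

/-!
# PercRepro — C-025 at `q = 3` for EVERY finite matroid, modulo the small-corank core cells (p2, gen 11)

Night-1's wrapper `ThmN.rls_succ_all` (RankLevelSetFrameQ, in the tree) reduces C-025 at `(p, 3)` for every finite
matroid and every `p ≥ 5` to Theorem N (`c025_two_all`, the `q = 2` row) and the CORE statement: `RLS M p 3` for every
simple matroid of rank `p ≥ 5` without coloops in which every element admits an `e`-free partition. `CoreCountCore`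
proves the core statement whenever `p ≥ 9` and the corank is `≥ amin p` (`8, 7, 7, 7, 6, 6, …`). So the ONLY core
cells left are: `p ≤ 8`, or corank `< amin p` — i.e. corank `≤ 5` for `p ≥ 13`, corank `≤ 6` for `10 ≤ p ≤ 12`,
corank `≤ 7` for `p = 9`. This file states that reduction as one theorem: C-025 at `q = 3` on every finite matroid
follows from the core statement on that finite family of small cells (`SmallCoreCells`).

* `SmallCoreCells` — the core statement on the cells `p ≤ 8 ∨ |E| < p + amin p` (a `Prop`, the exact kernel residue
  of the `q = 3` row at the level of the wrapper's core);
* **`c025_three_of_smallCoreCells`** — `SmallCoreCells → ∀ M [M.Finite] p, 5 ≤ p → ThmN.RLS M p 3`;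
* `SmallCoreCells'` — the same without the cells `p = 5, 6`, which are the tree theorems `(5,3)` (`ThmO.c025_five_three_all`)
  and `(6,3)` (`SixThree.c025_six_three`); `smallCoreCells_of`, **`c025_three_of_smallCoreCells'`**.
Imports `CoreCountCore`, `RankLevelSetFrameQ`, `TheoremOAll`, `SixThreeFinal`. Axioms: standard.
-/

namespace PercRepro
namespace CoreCount

/-- **The small-corank core cells**: the core statement of `rls_succ_all` at `q = 3` restricted to the cells
`p ≤ 8` or `|E| < p + amin p` (corank `≤ 5` for `p ≥ 13`, `≤ 6` for `10 ≤ p ≤ 12`, `≤ 7` for `p = 9`). -/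
def SmallCoreCells : Prop :=
  ∀ {α : Type} (M : Matroid α) [M.Finite] (p : ℕ), 5 ≤ p →
    (∀ e ∈ M.E, ∀ f ∈ M.E, e ≠ f → M.eRk {e, f} = 2) → M.eRank = (p : ℕ∞) →
    (∀ e, ¬ M.IsColoop e) →
    (∀ e ∈ M.E, ∃ A ⊆ M.E \ {e}, e ∉ M.closure A ∧ e ∉ M.closure ((M.E \ {e}) \ A)) →
    (p ≤ 8 ∨ M.E.ncard < p + CoreRegimes.amin p) → ThmN.RLS M p 3

/-- **C-025 at `q = 3` for every finite matroid and every `p ≥ 5`, given the small-corank core cells**: the wrapper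
`rls_succ_all` with Theorem N at `q = 2` and the core statement — `CoreCountCore` on the cells `p ≥ 9`,
`|E| ≥ p + amin p`, the hypothesis `SmallCoreCells` on the rest. -/
theorem c025_three_of_smallCoreCells (hsmall : SmallCoreCells) :
    ∀ {α : Type} (M : Matroid α) [M.Finite] (p : ℕ), 5 ≤ p → ThmN.RLS M p 3 := by
  intro α
  have h := ThmN.rls_succ_all (α := α) 2
    (fun M _ p hp => ThmN.c025_two_all M p hp)
    (fun M _ p hp hs hrank hcoloop hfree => by
      rcases Nat.lt_or_ge p 9 with h8 | h9
      · exact hsmall M p (by omega) hs hrank hcoloop hfree (Or.inl (by omega))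
      · rcases Nat.lt_or_ge M.E.ncard (p + CoreRegimes.amin p) with hlt | hge
        · exact hsmall M p (by omega) hs hrank hcoloop hfree (Or.inr hlt)
        · exact c025_core_sparse_amin M p h9 hs hfree hrank hge)
  intro M _ p hp
  exact h M p (by omega)


/-- **The small-corank core cells without `(5,3)` and `(6,3)`**: `p ∈ {7, 8}` or `|E| < p + amin p`. -/
def SmallCoreCells' : Prop :=
  ∀ {α : Type} (M : Matroid α) [M.Finite] (p : ℕ), 5 ≤ p →
    (∀ e ∈ M.E, ∀ f ∈ M.E, e ≠ f → M.eRk {e, f} = 2) → M.eRank = (p : ℕ∞) →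
    (∀ e, ¬ M.IsColoop e) →
    (∀ e ∈ M.E, ∃ A ⊆ M.E \ {e}, e ∉ M.closure A ∧ e ∉ M.closure ((M.E \ {e}) \ A)) →
    ((p = 7 ∨ p = 8) ∨ M.E.ncard < p + CoreRegimes.amin p) → ThmN.RLS M p 3

/-- The cells `p = 5, 6` are the tree theorems `(5,3)` and `(6,3)`. -/
theorem smallCoreCells_of (h : SmallCoreCells') : SmallCoreCells := by
  intro α M _ p hp hs hrank hcoloop hfree hcell
  rcases hcell with h8 | hlt
  · rcases (show p = 5 ∨ p = 6 ∨ p = 7 ∨ p = 8 by omega) with rfl | rfl | rfl | rfl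
    · exact ThmO.c025_five_three_all M
    · classical
      exact SixThree.c025_six_three M
    · exact h M 7 (by omega) hs hrank hcoloop hfree (Or.inl (Or.inl rfl))
    · exact h M 8 (by omega) hs hrank hcoloop hfree (Or.inl (Or.inr rfl))
  · exact h M p hp hs hrank hcoloop hfree (Or.inr hlt)

/-- **C-025 at `q = 3` for every finite matroid and every `p ≥ 5`, given the core cells `p ∈ {7, 8}` or corank
`< amin p`** — the exact kernel residue of the `q = 3` row. -/
theorem c025_three_of_smallCoreCells' (h : SmallCoreCells') :
    ∀ {α : Type} (M : Matroid α) [M.Finite] (p : ℕ), 5 ≤ p → ThmN.RLS M p 3 :=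
  c025_three_of_smallCoreCells (smallCoreCells_of h)

end CoreCount
end PercRepro
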